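import Summits.PneNP.PneNP.Theorems.SoloInformedIOShape
import Summits.PneNP.PneNP.Theorems.SoloInformedQuantifierShape
import Summits.PneNP.PneNP.Theorems.SoloInformedRefuters
import Summits.PneNP.PneNP.Theorems.SoloInformedSparse
import Summits.PneNP.PneNP.Theorems.SoloInformedSelective
import Summits.PneNP.PneNP.Theorems.SoloInformedLogAdvice
import Summits.PneNP.PneNP.Theorems.SoloInformedOneWay
import Summits.PneNP.PneNP.Theorems.SoloInformedWitnessKt
import Summits.PneNP.PneNP.Theorems.SoloInformedInstanceHard
import Summits.PneNP.PneNP.Theorems.SoloInformedLevin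
import Summits.PneNP.PneNP.Theorems.SoloInformedLinearLadderIff
import Summits.PneNP.PneNP.Theorems.SoloInformedResBoundNP
import Summits.PneNP.PneNP.Theorems.SoloInformedResAutomatable
import HarnessLib

/-!
# The faces of the summit: one `TFAE`

Soloist file (`solo-PneNP-informed`, summit-directed charter; landing prefix `SoloInformed`).
Nothing here is progress toward `P ≠ NP`. This file only COLLECTS, into a single kernel-checked
`List.TFAE`, the hypothesis-free equivalents of `PneNP` landed one by one in the `SoloInformed*`
files — so that "the summit restated" has one citable address and every face is visibly the SAME
statement:

 1. `PneNP` (the audited statement);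
 2. `∃ L ∈ NP, L ∉ P` over the prelude classes (`SoloInformedIOShape`);
 3. `∃ L ∈ NP, ∀ k, L ∉ DTIME(nᵏ)` and 4. `∀ k, SAT ∉ DTIME(nᵏ)` — the quantifier shape: ONE language,
    infinitely often, against EVERY exponent (`SoloInformedQuantifierShape`);
 5. every `D ∈ P` errs on `SAT` infinitely often (`SoloInformedIOShape`);
 6. … on a non-sparse set (Mahaney for `P`-close sets, `SoloInformedSparse`);
 7.–8. … and the errors are produced by a polynomial-time refuter: constructive separation of padded
    `SAT` / an explicit instance generator hitting the error set infinitely often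
    (Gutfreund–Shaltiel–Ta-Shma shape, `SoloInformedRefuters`);
 9. `∀ k, NTIME(n) ⊄ DTIME(nᵏ)` and 10. `Wlin ∉ P` — the linear-time ladder
    (`SoloInformedLinearLadderIff`);
 11. `RESBOUND ∉ P` — bounded-length Resolution refutability, NP-complete in the tree
    (Atserias–Müller decision form, `SoloInformedResBoundNP`);
 12. no `g ∈ FP` pad-automates Resolution (search form, `SoloInformedResAutomatable`);
 13. no sparse `NP`-hard set (Mahaney) and 14. no tally `NP`-hard set (Berman) (`SoloInformedSparse`);
 15. `SAT` has no polynomial-time selector (Selman, `SoloInformedSelective`);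
 16. padded `SAT ∉ P/log` (`SoloInformedLogAdvice`);
 17. a worst-case one-way function exists (`SoloInformedOneWay`);
 18. some `NP` search problem has witnesses of unbounded Levin cost on the tree's fixed universal
    machine `stdU` (`SoloInformedWitnessKt`);
 19. `SAT` has infinitely many instances hard for every `O(log n)`-size, `n^a`-time correct program on
    `stdU` (instance complexity, `SoloInformedInstanceHard`);
 20. Levin's universal function on `stdU` is worst-case one-way at some exponent (`SoloInformedLevin`).

Each `k ↔ 1` is the corresponding landed theorem, cited by name in the proof; `tfae_finish` does
the rest. Faces that are only ONE-DIRECTIONAL neighbours in the tree (the McKay–Murray–Williams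
streaming door `StreamingLowerBound(nᵏ) → PneNP` of `SoloInformedStreaming`, the almost-everywhere
form `NP ⊄ io-P → PneNP` of `SoloInformedIOShape`) are deliberately NOT in the list.

References: as in the cited files (Cook 2000 §1; Arora–Barak 2009 Thms 1.9, 2.8, 2.10, §20.1;
Mahaney 1982; Berman 1978; Selman 1979; Gutfreund–Shaltiel–Ta-Shma 2007; Levin 1973;
Orponen–Ko–Schöning–Watanabe 1994; Atserias–Müller 2020 Thm 1). Standard axioms only.
-/

namespace Summit.PneNP.PneNP.Theorems

open Literature.Computability.Complexity Literature.Computability.MetaComplexity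
open Literature.Computability.Cryptography _root_.Computability Filter

/-- **The faces of the summit.** Twenty hypothesis-free statements of the tree, all equivalent to
`PneNP` (`P ≠ NP`), collected from the `SoloInformed*` files into one `List.TFAE`; see the module
docstring for the numbering and sources. Use `soloInformed_faces_tfae.out i j` to pass between any
two faces. -/
theorem soloInformed_faces_tfae : List.TFAE [
    PneNP,
    ∃ L ∈ Nondeterministic.NP, L ∉ Classes.P,
    ∃ L ∈ Nondeterministic.NP, ∀ k : ℕ, L ∉ DTIME (fun n => n ^ k),
    ∀ k : ℕ, SAT ∉ DTIME (fun n => n ^ k),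
    ∀ D ∈ Classes.P, ({x : List Bool | x ∈ SAT ↔ x ∉ D} : Set (List Bool)).Infinite,
    ∀ D ∈ Classes.P, ¬ Literature.Barriers.PneNP.IsSparseLanguage {φ | φ ∈ SAT ↔ φ ∉ D},
    HasPConstructiveSeparation (onesZeroPad SAT) Classes.P,
    ∀ D ∈ Classes.P, ∃ R : ℕ → List Bool,
      PolyTimeComputable Computability.unaryEncodeNat (id : List Bool → List Bool) R ∧
        (∀ n, (R n).length ≤ n) ∧ ∃ᶠ n in atTop, (R n ∈ SAT ↔ R n ∉ D),
    ∀ k : ℕ, ¬ (NTIME (fun n => n) ⊆ DTIME (fun n => n ^ k)),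
    SoloLinearLadder.Wlin ∉ Classes.P,
    resBoundLang ∉ Classes.P,
    ∀ g ∈ FP, g ∉ resPadSearchFns,
    ∀ T : Language Bool, IsHard Nondeterministic.NP T → ¬ Literature.Barriers.PneNP.IsSparseLanguage T,
    ∀ T : Language Bool, IsHard Nondeterministic.NP T → ¬ Literature.Barriers.PneNP.IsTally T,
    ¬ ∃ s ∈ FP, ∀ a b : List Bool, (s (boolPair a b) = a ∨ s (boolPair a b) = b) ∧
        ((a ∈ SAT ∨ b ∈ SAT) → s (boolPair a b) ∈ SAT),
    ¬ ∃ T' ∈ Classes.P, ∃ a : ℕ → List Bool, ∃ c : ℕ,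
      (∀ n, (a n).length ≤ c * Nat.log 2 n + c) ∧
        ∀ y, y ∈ onesZeroPad SAT ↔ boolPair y (a y.length) ∈ T',
    ∃ f ∈ FP, ∀ g ∈ FP, ∃ (n : ℕ) (x : List Bool), x.length = n ∧
      f (g (boolPair (unaryEncodeNat n) (f x))) ≠ f x,
    ∃ R ∈ Classes.P, ∃ p : Polynomial ℕ, ∀ c : ℕ, ∃ x : List Bool,
      (∃ y : List Bool, y.length ≤ p.eval x.length ∧ boolPair x y ∈ R) ∧
        ∀ (π y : List Bool) (t : ℕ), π.length ≤ c * Nat.log 2 x.length + c →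
          t ≤ x.length ^ c + c → stdU.run (boolPair π x) t = some y →
            ¬ (y.length ≤ p.eval x.length ∧ boolPair x y ∈ R),
    ∀ a c : ℕ, Set.Infinite {x : List Bool | x ∈ SAT ∧ ∀ π : List Bool,
      π.length ≤ c * Nat.log 2 x.length + c →
      (∀ (y : List Bool) (t : ℕ) (b : Bool),
        stdU.run (boolPair π y) t = some [b] → (b = true ↔ y ∈ SAT)) →
      ∀ b : Bool, stdU.run (boolPair π x) (x.length ^ a + a) ≠ some [b]},
    ∃ d : ℕ, ∀ G ∈ FP, ∃ (m : ℕ) (z : List Bool), z.length = m ∧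
      levinUniv stdU d (G (boolPair (unaryEncodeNat m) (levinUniv stdU d z))) ≠ levinUniv stdU d z] := by
  tfae_have 1 ↔ 2 := soloInformed_pneNP_iff_exists_not_mem
  tfae_have 1 ↔ 3 := soloInformed_pneNP_iff_exists_forall_not_mem_DTIME
  tfae_have 1 ↔ 4 := soloInformed_pneNP_iff_sat_forall_not_mem_DTIME
  tfae_have 1 ↔ 5 := soloInformed_pneNP_iff_sat_infinitely_often_wrong
  tfae_have 1 ↔ 6 := soloInformed_pneNP_iff_sat_errors_not_sparse
  tfae_have 1 ↔ 7 := soloInformed_pneNP_iff_padSAT_refutable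
  tfae_have 1 ↔ 8 := soloInformed_pneNP_iff_sat_refutable
  tfae_have 1 ↔ 9 := soloInformed_pneNP_iff_forall_not_NTIME_id_subset_DTIME_pow
  tfae_have 1 ↔ 10 := soloInformed_pneNP_iff_Wlin_not_mem_P
  tfae_have 1 ↔ 11 := soloInformed_pneNP_iff_resBound
  tfae_have 1 ↔ 12 := soloInformed_pneNP_iff_forall_not_mem_resPadSearchFns
  tfae_have 1 ↔ 13 := soloInformed_pneNP_iff_no_sparse_hard_set
  tfae_have 1 ↔ 14 := soloInformed_pneNP_iff_no_tally_hard_set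
  tfae_have 1 ↔ 15 := soloInformed_pneNP_iff_no_selector_for_SAT
  tfae_have 1 ↔ 16 := soloInformed_pneNP_iff_padSAT_not_mem_logAdvice
  tfae_have 1 ↔ 17 := soloInformed_pneNP_iff_exists_worstCase_oneWay
  tfae_have 1 ↔ 18 := soloInformed_pneNP_iff_costly_witnesses_stdU
  tfae_have 1 ↔ 19 := soloInformed_pneNP_iff_sat_infinite_hard_instances_stdU
  tfae_have 1 ↔ 20 := soloInformed_pneNP_iff_exists_levinUniv_oneWay stdU
  tfae_finish

/-- Sanity export: any face gives the summit — e.g. face 11, `RESBOUND ∉ P → PneNP`, read off the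
`TFAE` (the same statement as `soloInformed_pneNP_iff_resBound.mpr`). -/
theorem soloInformed_pneNP_of_face_resBound (h : resBoundLang ∉ Classes.P) : PneNP :=
  (soloInformed_faces_tfae.out 0 10).mpr h

end Summit.PneNP.PneNP.Theorems
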